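import Mathlib
import HarnessLib
import Summits.ValiantsHypothesis.ValiantsHypothesis.Theorems.MonotoneRestorationMonotoneRestorationQPSimpleGraphCutCompare
import Summits.ValiantsHypothesis.ValiantsHypothesis.Theorems.MonotoneRestorationOrbitRestorationLinearVolumeQPKillIrrefutable
import Summits.ValiantsHypothesis.ValiantsHypothesis.Theorems.MonotoneRestorationPolylogWidthMonotoneEasyStatus

/-!
# Route MonotoneRestoration — in the lossless simple-graph cuts, the FINITE-MODEL-THEORY HALF ALONE DECIDES THE SUMMIT;
# the circuit halves (W₁, Wᵐ) and the compression aside (L2) are surplus for VP ≠ VNP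

Helper file (`--supports`), def-free; one-line consequences, by name, of the cuts
`SimpleGraphCut.orbitRestorationQP_iff_simpleGraphCut` (p825758) / `…_iff_cut_witness` (p825944) /
`monotoneRestorationQP_iff_cut_witness` (p825855) and the tree's `valiantsHypothesis_of_not_polylogWidthVP`,
`valiantsHypothesis_of_not_polylogWidthMonotoneEasy` (`VP = VNP` makes the permanent a polylog-width `VP` family):

* `valiantsHypothesis_of_simpleGraphHalf` — H₁ (every matrix-symmetric `VP` family eventually `C^{polylog}`-determined on
  simple graphs) ⇒ `ValiantsHypothesis`;
* `valiantsHypothesis_of_thresholdFreeHalf` — the same with the threshold-free H₁ (the reshaped line's `stub_noArithmeticCFI`);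
* `valiantsHypothesis_of_monotoneHalf` — Hᵐ (the monotone-easy version, = `¬ PolylogWidthMonotoneEasy`) ⇒ `ValiantsHypothesis`;
* `valiantsHypothesis_of_registeredGap2` — the REGISTERED GAP 2 of line `linear_width` (`HomDeterminedVP`, unfolded) ⇒
  `ValiantsHypothesis` (through `simpleGraphHalf_of_homDeterminedVP`).

So for items 18293 / 16191 / 15886 the summit-deciding content is exactly "no (monotone-easy) arithmetic Cai–Fürer–Immerman
family in characteristic 0"; W₁, Wᵐ, L2, the rung and GAP 1 of line `linear_width` are VH-free surplus (they matter for the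
cruxes as stated, not for the summit).  Honest label: by-name glue; nothing closed; VP ≠ VNP NOT moved.
[cite: DawarWilsenach2025, Thm 7.2, §8]
-/

-- `Summit.ValiantsHypothesis.ValiantsHypothesis.…` is the tree's mandated namespace (Sub = Summit).
set_option linter.dupNamespace false

noncomputable section

namespace Summit.ValiantsHypothesis.ValiantsHypothesis.Theorems

namespace SimpleGraphCut

open Summit.ValiantsHypothesis.ValiantsHypothesis.Theses.MonotoneRestoration
open Literature.Computability.AlgebraicComplexity
open Literature.ModelTheory.FiniteModelTheory
open MonotoneRestorationQPLinearWidth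
open MvPolynomial

/-- **H₁ ⇒ VH.** [cite: DawarWilsenach2025, Thm 7.2] -/
theorem valiantsHypothesis_of_simpleGraphHalf
    (hH : ∀ f : (n : ℕ) → MvPolynomial (Fin n × Fin n) ℂ, IsMatrixSymmetric f → IsVPFamily f →
      ∃ c N : ℕ, ∀ m : ℕ, N ≤ m → ∀ X Y : SimpleGraph (Fin m), CkEquiv ((Nat.log 2 m + c) ^ c) X Y →
        MvPolynomial.eval (Set.indicator {ij : Fin m × Fin m | X.Adj ij.1 ij.2} 1) (f m) =
          MvPolynomial.eval (Set.indicator {ij : Fin m × Fin m | Y.Adj ij.1 ij.2} 1) (f m)) :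
    _root_.ValiantsHypothesis :=
  OrbitRestorationLinearVolumeQPVHStrength.valiantsHypothesis_of_not_polylogWidthVP
    (simpleGraphHalf_iff_not_polylogWidthVP.mp hH)

/-- **Threshold-free H₁ ⇒ VH** (the reshaped line's `stub_noArithmeticCFI` alone decides the summit). [cite: DawarWilsenach2025, Thm 7.2] -/
theorem valiantsHypothesis_of_thresholdFreeHalf
    (hH : ∀ f : (n : ℕ) → MvPolynomial (Fin n × Fin n) ℂ, IsMatrixSymmetric f → IsVPFamily f →
      ∃ c : ℕ, ∀ (m : ℕ) (X Y : SimpleGraph (Fin m)), CkEquiv ((Nat.log 2 m + c) ^ c) X Y →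
        MvPolynomial.eval (Set.indicator {ij : Fin m × Fin m | X.Adj ij.1 ij.2} 1) (f m) =
          MvPolynomial.eval (Set.indicator {ij : Fin m × Fin m | Y.Adj ij.1 ij.2} 1) (f m)) :
    _root_.ValiantsHypothesis :=
  valiantsHypothesis_of_simpleGraphHalf fun f hs hVP => by
    obtain ⟨c, hc⟩ := hH f hs hVP
    exact ⟨c, 0, fun m _ X Y hXY => hc m X Y hXY⟩

/-- **Hᵐ ⇒ VH** (the monotone-easy finite-model-theory half alone decides the summit). [cite: DawarWilsenach2025, Thm 7.2] -/
theorem valiantsHypothesis_of_monotoneHalf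
    (hH : ∀ f : (n : ℕ) → MvPolynomial (Fin n × Fin n) NNReal,
      (∀ (n : ℕ) (σ τ : Equiv.Perm (Fin n)),
        MvPolynomial.rename (fun p : Fin n × Fin n => (σ p.1, τ p.2)) (f n) = f n) →
      (∃ c : ℕ, ∀ n : ℕ, (f n).totalDegree ≤ (n + 2) ^ c ∧ complexity (k := NNReal) (f n) ≤ (n + 2) ^ c) →
      ∃ c N : ℕ, ∀ m : ℕ, N ≤ m → ∀ X Y : SimpleGraph (Fin m), CkEquiv ((Nat.log 2 m + c) ^ c) X Y →
        MvPolynomial.eval (Set.indicator {ij : Fin m × Fin m | X.Adj ij.1 ij.2} 1)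
            (MvPolynomial.map (Complex.ofRealHom.comp NNReal.toRealHom) (f m)) =
          MvPolynomial.eval (Set.indicator {ij : Fin m × Fin m | Y.Adj ij.1 ij.2} 1)
            (MvPolynomial.map (Complex.ofRealHom.comp NNReal.toRealHom) (f m))) :
    _root_.ValiantsHypothesis :=
  valiantsHypothesis_of_not_polylogWidthMonotoneEasy (monotoneHalf_iff_not_polylogWidthMonotoneEasy.mp hH)

/-- **Registered GAP 2 ⇒ VH** (`HomDeterminedVP` of line `linear_width`, unfolded, alone decides the summit).
[cite: DawarWilsenach2025, Thm 7.2] -/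
theorem valiantsHypothesis_of_registeredGap2
    (hGAP2 : ∀ f : (n : ℕ) → MvPolynomial (Fin n × Fin n) ℂ,
      IsMatrixSymmetric f → IsVPFamily f → PolylogHomDetermined f) :
    _root_.ValiantsHypothesis :=
  valiantsHypothesis_of_simpleGraphHalf (simpleGraphHalf_of_homDeterminedVP hGAP2)

end SimpleGraphCut

end Summit.ValiantsHypothesis.ValiantsHypothesis.Theorems

end
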